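import Summits.Ventures.Crystal3D.Theorems.StickyWulffConstantGenericWallFloorBarlowLineFamily
import HarnessLib

/-!
# The LINE SET of a finite set of plate balls (F4 glue, G-side: producing lane T's `T₁ ⊇ {lines with a window vertex}` as a Finset)
# (crux `GenericWallFloor`, stmt-Ventures-19480, line `WallLedgerG`; lane T's F4)

HONEST FRAMING. Venture `Summits/Ventures/Crystal3D` (cell `crystal3d-full`), helper `--supports` the crux `GenericWallFloor`
(stmt-Ventures-19480) of `route-Ventures-StickyWulffConstant`, registered line `WallLedgerG`, open stub `stub_twoSlabAdhesion`.
Rung credit only; F-C1 not moved; NOT the stub.  Pure bookkeeping.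

Lane T's covered glue asks for a finite set `T₁` of line indices `t ∈ ℤ²` CONTAINING every line with a vertex
`L (vertex k + t₀u + t₁v) + s₀` in the window; F4 bounds `#T₁` by walkers, so `T₁` must not be larger than necessary.  For a
polyline `vertex` with one site per layer (`vertex k ∈ barlowLayer σ k`), every moved site of the stacking lies on exactly one line,
so a finite set `P` of moved sites (the window balls of the plate) determines its lines:

* **`lineSet_of_sites`** — there is a Finset `Tl` with (i) every line having a vertex in `P` belongs to `Tl`, (ii) every `t ∈ Tl`
  has a vertex in `P`, (iii) `#Tl ≤ #P`.
With `P = P₁ ∩ window` this is the `T₁` of the covered glue's hypothesis and the `Tl` of `lineFamily_spec`.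
WHAT THIS IS NOT: not F4; F-C1 not moved.
-/

noncomputable section

namespace Summit.Ventures.Crystal3D.Theorems

open Finset
open Literature.MathematicalPhysics.StatisticalMechanics
open scoped InnerProductSpace

open scoped Classical in
/-- **The line set of a finite set of moved sites.**  See the module docstring. -/
theorem lineSet_of_sites (σ : ℤ → ℤ) (L : EuclideanSpace ℝ (Fin 3) ≃ₗᵢ[ℝ] EuclideanSpace ℝ (Fin 3)) (s₀ : EuclideanSpace ℝ (Fin 3))
    (vertex : ℤ → EuclideanSpace ℝ (Fin 3)) (hlayer : ∀ k, vertex k ∈ barlowLayer 1 (Real.sqrt (2 / 3)) σ k)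
    (P : Finset (EuclideanSpace ℝ (Fin 3)))
    (hP : ∀ q ∈ P, ∃ k i j : ℤ, q = L (barlowPos 1 (Real.sqrt (2 / 3)) σ k i j) + s₀) :
    ∃ Tl : Finset (Fin 2 → ℤ),
      (∀ t : Fin 2 → ℤ, (∃ k : ℤ, L (vertex k + ((t 0 : ℝ) • triangularVec₁ 1 + (t 1 : ℝ) • triangularVec₂ 1)) + s₀ ∈ P) → t ∈ Tl) ∧
      (∀ t ∈ Tl, ∃ k : ℤ, L (vertex k + ((t 0 : ℝ) • triangularVec₁ 1 + (t 1 : ℝ) • triangularVec₂ 1)) + s₀ ∈ P) ∧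
      Tl.card ≤ P.card := by
  set uv : (Fin 2 → ℤ) → EuclideanSpace ℝ (Fin 3) := fun t => (t 0 : ℝ) • triangularVec₁ 1 + (t 1 : ℝ) • triangularVec₂ 1 with huv
  choose x y hxy using hlayer
  -- every line vertex is a site; sites on lines are unique
  have hsite : ∀ (k : ℤ) (t : Fin 2 → ℤ), vertex k + uv t = barlowPos 1 (Real.sqrt (2 / 3)) σ k (x k + t 0) (y k + t 1) := by
    intro k t; rw [hxy k, huv]; exact barlowPos_add_inplane 1 (Real.sqrt (2 / 3)) σ k (x k) (y k) (t 0) (t 1)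
  have huniq : ∀ (k k' : ℤ) (t t' : Fin 2 → ℤ), vertex k + uv t = vertex k' + uv t' → k = k' ∧ t = t' := by
    intro k k' t t' h
    rw [hsite, hsite] at h
    obtain ⟨hk, ha, hb⟩ := barlowPos_injective σ h
    subst hk
    refine ⟨rfl, ?_⟩
    funext r
    fin_cases r
    · show t 0 = t' 0; omega
    · show t 1 = t' 1; omega
  -- every site is a line vertex
  have honline : ∀ k i j : ℤ, barlowPos 1 (Real.sqrt (2 / 3)) σ k i j = vertex k + uv ![i - x k, j - y k] := by
    intro k i j
    rw [hsite]
    simp only [Matrix.cons_val_zero, Matrix.cons_val_one]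
    congr 1 <;> ring
  -- the line index of a site
  set idx : EuclideanSpace ℝ (Fin 3) → (Fin 2 → ℤ) := fun q =>
    if h : ∃ kt : ℤ × (Fin 2 → ℤ), L (vertex kt.1 + uv kt.2) + s₀ = q then (Classical.choose h).2 else 0 with hidx
  have hidx_spec : ∀ (k : ℤ) (t : Fin 2 → ℤ), idx (L (vertex k + uv t) + s₀) = t := by
    intro k t
    have h : ∃ kt : ℤ × (Fin 2 → ℤ), L (vertex kt.1 + uv kt.2) + s₀ = L (vertex k + uv t) + s₀ := ⟨(k, t), rfl⟩
    simp only [hidx, dif_pos h]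
    have hc := Classical.choose_spec h
    have hc' : vertex (Classical.choose h).1 + uv (Classical.choose h).2 = vertex k + uv t :=
      L.injective (add_right_cancel hc)
    exact (huniq _ _ _ _ hc').2
  refine ⟨P.image idx, fun t ⟨k, hk⟩ => Finset.mem_image.2 ⟨_, hk, hidx_spec k t⟩, fun t ht => ?_, Finset.card_image_le⟩
  obtain ⟨q, hq, hqt⟩ := Finset.mem_image.1 ht
  obtain ⟨k, i, j, rfl⟩ := hP q hq
  refine ⟨k, ?_⟩
  rw [honline] at hq hqt
  rw [hidx_spec] at hqt
  subst hqt
  exact hq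

end Summit.Ventures.Crystal3D.Theorems

end
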